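import Mathlib
import Literature.Probability.LatticeModels.ClusterExpansionKPBound
import Summits.QuantumFields.BalabanUV.Beta.MarkedResummation344

/-!
# Beta / MarkedLocalized347 — BINDER-OWNERS row D4, co-owner road P2′: the LOCALIZED marked expansion [Balaban1988Convergent]
# (3.46) → (3.47) p. 278 as a kernel IDENTITY — the exponent of (3.45) regrouped by localization domain (3.46), its Mayer
# expansion, and the resummation of the marked expectation into terms indexed by localization domains X ∋ b (3.47);
# Part A (identities + the termwise majorant); abstract polymer gas, by name from `MarkedResummation344` / `ClusterExpansion`
# (β sub-cell, unit `b2b-balaban-beta-d4-p2`, generation 1; leaf R.3 (identity half) of `HOME/beta/skeletons/D4-b2b-balaban-beta-d4-p2.md`)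

HONEST FRAMING (page 1 of everything the β sub-cell writes): discharging `BetaPertH` makes Bałaban's UV stability
UNCONDITIONAL — a real constructive-QFT result; it is NOT the continuum limit and NOT the Clay problem.  HONEST DEPENDENCY
(cell reorg 2026-08-19, verbatim): «continuum YM on T⁴ ⇐ BetaPertH ∧ nine spine estimates (0/9 proved); BetaPertH ⇐ (D1) ∧
(D4) ∧ CAP+tail; G-an2-4 gates asym, D1 and NE2/3/4.»  THIS MODULE INSTANTIATES NO BINDER AND ASSERTS NOTHING ABOUT
BAŁABAN'S ACTIVITIES: finite algebra of an ABSTRACT hard-core polymer gas with footprints, proved from Mathlib and the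
UNMODIFIED modules `Literature.Probability.LatticeModels.ClusterExpansion(KPBound)` and the co-owner's `MarkedResummation344`.

ABSOLUTE RULE (cell charter, verbatim): "No internally-minted statement may enter as a cited fact. Every hypothesis is
either kernel-proved in this package or a verbatim quotation of a PUBLISHED theorem with page reference. The manuscript(s)
under audit are NOT citable for their own disputed steps — they are the thing under adjudication; programme-internal
(2001/route/tribunal) claims are never citable."  Nothing is cited as a fact here.

## The printed text ([III] = [Balaban1988Convergent], CMP 119, p. 278 [PDF 36], render p036 READ AS AN IMAGE)

*«The difference in the exponential has the representation (I.7.12) with (Z₁,…,Z_n) satisfying the additional condition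
that at least one of the localization domains intersects Z₀ along a three-dimensional wall at least. Resumming the terms of
this representation according to (I.7.13), we obtain
   [the expectation value in (3.37)] = Σ_{Z₀∋b} H′(Z₀) exp[ −Σ_Y Ẽ^{(k+1)}(Λ_{k+1}, Y) ].   (3.46)
The sum in the exponential is over the localization domains Y satisfying both conditions relative to Λ_{k+1}, Z₀. Finally,
the exponential on the right-hand side of (3.46) is expanded into the Mayer expansion, as the action density (I.7.1). This,
after the proper resummation, yields the representation
   [the expectation value in (3.37)] = Σ_{X∈𝐃_{k+1}, X∋b} 𝐄₀^{(k+1)}(Λ_{k+1}, X, b).   (3.47)»*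

## What is typed (Part A = the identities; Part B = the tree-decay bound of the X-terms is the remaining swarm leaf R.3-B)

Setting as in `MarkedResummation344`: polymers `P` with `inc` (reflexive, symmetric), catalogue `Λ`, unmarked activities
`w` (a Kotecký–Preiss volume), marked activities `w′` on `Mk ⊆ Λ`; in addition FOOTPRINTS `fp : P → Finset Cube`.
* §1 `touchLocE Λ Z₀ Y` := Σ_{C ⊆ Λ, C meets incompatWith Λ Z₀, ∪_{Z∈C} fp Z = Y} Φ^T(C; w) — the localized exponent
  «Ẽ(Λ, Y) over the Y satisfying both conditions»; `sum_touchLocE_eq`: the exponent of `markedExpect_eq_sum_exp`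
  regrouped by footprint = (3.46).
* §2 the Mayer expansion of the exponential over a finite footprint catalogue `Ys`: `exp(−Σ_{Y∈Ys} t Y) =
  Σ_{F ⊆ Ys} Π_{Y∈F} (e^{−t Y} − 1)` (`cexp_neg_sum_eq_sum_powerset`, Mathlib `Finset.prod_one_add`); the X-LOCALIZED
  part `mloc Ys t F₀ X := Σ_{F ⊆ Ys : F₀ ∪ ⋃F = X} Π (e^{−tY} − 1)` and `sum_mloc_eq`: Σ_X mloc X = exp(−Σ t) — (3.47)'s
  «proper resummation», footprint of the marked polymer `F₀ = fp Z₀` included in X.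
* §3 the termwise majorant: `‖e^{−z} − 1‖ ≤ ‖z‖e^{‖z‖}` (`norm_cexp_neg_sub_one_le`) and
  `norm_mloc_le`: ‖mloc X‖ ≤ Σ_{F} Π ‖tY‖e^{‖tY‖} — the input of Part B's anchored family-sum bound
  (`B13FamilySum.familySum_le_one_via227` / `Ineq126` / `VolBound`, exactly as in `B13Resummation.norm_locE_le`).
NOT typed here: Part B (the bound ‖Σ_{Z₀} w′(Z₀)·mloc_{Z₀} X‖ ≤ m·const·e^{−κ′ d(X)}), i.e. the `h118`-shaped output.
NOT CLAIMED: anything about Bałaban's Ẽ, H′; NOT BetaPertH, NOT continuum, NOT Clay.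
-/

namespace Summit.QuantumFields.BalabanUV.Beta.MarkedLocalized347

open Finset
open Literature.Probability.LatticeModels
open Summit.QuantumFields.BalabanUV.Beta.MarkedResummation344

noncomputable section

variable {P Cube : Type*} [DecidableEq P] [DecidableEq Cube] {inc : P → P → Prop} [DecidableRel inc]

/-! ## §1 (3.46): the exponent regrouped by localization domain -/

/-- The clusters of the catalogue `Λ` that TOUCH `Z₀` (meet the polymers incompatible with Z₀) — the index set of the
exponent in `markedExpect_eq_sum_exp`. -/
def touchingClusters (inc : P → P → Prop) [DecidableRel inc] (Λ : Finset P) (Z₀ : P) : Finset (Finset P) :=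
  Λ.powerset.filter fun C => (C ∩ incompatWith inc Λ Z₀).Nonempty

/-- **Ẽ(Λ, Y) for the Y «satisfying both conditions relative to Λ, Z₀»**: the truncated functionals of the touching
clusters whose footprint union is exactly `Y`. -/
def touchLocE (inc : P → P → Prop) [DecidableRel inc] (fp : P → Finset Cube) (w : P → ℂ) (Λ : Finset P) (Z₀ : P)
    (Y : Finset Cube) : ℂ :=
  ∑ C ∈ (touchingClusters inc Λ Z₀).filter (fun C => C.biUnion fp = Y), truncatedWeight inc w C

/-- The finite catalogue of footprints of touching clusters (the «Y» of (3.46)). -/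
def touchFootprints (inc : P → P → Prop) [DecidableRel inc] (fp : P → Finset Cube) (Λ : Finset P) (Z₀ : P) :
    Finset (Finset Cube) :=
  (touchingClusters inc Λ Z₀).image fun C => C.biUnion fp

/-- **(3.46) — regrouping the exponent by footprint**: Σ_{C touching Z₀} Φ^T(C) = Σ_{Y} Ẽ(Λ, Z₀; Y). -/
theorem sum_touchLocE_eq (fp : P → Finset Cube) (w : P → ℂ) (Λ : Finset P) (Z₀ : P) :
    ∑ Y ∈ touchFootprints inc fp Λ Z₀, touchLocE inc fp w Λ Z₀ Y =
      ∑ C ∈ Λ.powerset with (C ∩ incompatWith inc Λ Z₀).Nonempty, truncatedWeight inc w C := by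
  unfold touchLocE touchFootprints touchingClusters
  exact Finset.sum_fiberwise_of_maps_to (fun C hC => Finset.mem_image_of_mem _ hC) _

/-- **(3.45) → (3.46)**: under the Kotecký–Preiss condition the marked expectation is
`Σ_{Z₀∈Mk} w′(Z₀)·exp(−Σ_Y Ẽ(Λ, Z₀; Y))`. -/
theorem markedExpect_eq_sum_exp_touchLocE [Std.Refl inc] [Std.Symm inc] (fp : P → Finset Cube) {w : P → ℂ}
    {a : P → ℝ} {Λ : Finset P} (hKP : IsKPVolume inc w a Λ) (w' : P → ℂ) (Mk : Finset P) :
    markedExpect inc w w' Λ Mk =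
      ∑ Z₀ ∈ Mk, w' Z₀ * Complex.exp (-∑ Y ∈ touchFootprints inc fp Λ Z₀, touchLocE inc fp w Λ Z₀ Y) := by
  rw [markedExpect_eq_sum_exp hKP]
  refine sum_congr rfl fun Z₀ _ => ?_
  rw [sum_touchLocE_eq]

/-! ## §2 The Mayer expansion of the exponential and its localization (3.47) -/

/-- The Mayer factor `e^{−t(Y)} − 1`. -/
def mayerU {κ : Type*} (t : κ → ℂ) (Y : κ) : ℂ := Complex.exp (-t Y) - 1

/-- **Mayer expansion of the exponential**: `exp(−Σ_{Y∈Ys} t Y) = Σ_{F ⊆ Ys} Π_{Y∈F} (e^{−tY} − 1)`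
(«expanded into the Mayer expansion, as the action density (I.7.1)»). -/
theorem cexp_neg_sum_eq_sum_powerset {κ : Type*} [DecidableEq κ] (Ys : Finset κ) (t : κ → ℂ) :
    Complex.exp (-∑ Y ∈ Ys, t Y) = ∑ F ∈ Ys.powerset, ∏ Y ∈ F, mayerU t Y := by
  rw [← Finset.prod_one_add, ← Finset.sum_neg_distrib, Complex.exp_sum]
  refine prod_congr rfl fun Y _ => ?_
  simp [mayerU]

/-- **The X-localized part of the Mayer-expanded exponential of the marked term**: the families `F` of touching
footprints whose union TOGETHER WITH the marked footprint `F₀ = fp Z₀` is exactly `X`. -/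
def mloc (Ys : Finset (Finset Cube)) (t : Finset Cube → ℂ) (F₀ X : Finset Cube) : ℂ :=
  ∑ F ∈ Ys.powerset with F₀ ∪ F.biUnion id = X, ∏ Y ∈ F, mayerU t Y

/-- The finite set of localization domains X produced from `F₀` and the catalogue `Ys`. -/
def locDomains (Ys : Finset (Finset Cube)) (F₀ : Finset Cube) : Finset (Finset Cube) :=
  Ys.powerset.image fun F => F₀ ∪ F.biUnion id

/-- **(3.47)'s «proper resummation»**: `Σ_X mloc X = exp(−Σ_{Y∈Ys} t Y)`. -/
theorem sum_mloc_eq (Ys : Finset (Finset Cube)) (t : Finset Cube → ℂ) (F₀ : Finset Cube) :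
    ∑ X ∈ locDomains Ys F₀, mloc Ys t F₀ X = Complex.exp (-∑ Y ∈ Ys, t Y) := by
  rw [cexp_neg_sum_eq_sum_powerset]
  unfold mloc locDomains
  exact Finset.sum_fiberwise_of_maps_to (fun F hF => Finset.mem_image_of_mem _ hF) _

/-- Every localization domain CONTAINS the marked footprint (X ∋ b in (3.47)). -/
theorem subset_of_mem_locDomains {Ys : Finset (Finset Cube)} {F₀ X : Finset Cube} (hX : X ∈ locDomains Ys F₀) :
    F₀ ⊆ X := by
  obtain ⟨F, _, rfl⟩ := Finset.mem_image.1 hX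
  exact subset_union_left

/-- **(3.47) — THE LOCALIZED MARKED EXPANSION (identity)**: under the KP condition,
`⟨F_b⟩ = Σ_{Z₀∈Mk} Σ_{X ⊇ fp Z₀} w′(Z₀) · mloc_{Z₀}(X)` — the marked expectation as a sum of terms indexed by the marked
polymer and a localization domain containing it; `𝐄₀^{(k+1)}(Λ, X, b)` of (3.47) is the regrouping `Σ_{Z₀∋b} w′(Z₀)mloc_{Z₀}(X)`. -/
theorem markedExpect_eq_sum_mloc [Std.Refl inc] [Std.Symm inc] (fp : P → Finset Cube) {w : P → ℂ} {a : P → ℝ}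
    {Λ : Finset P} (hKP : IsKPVolume inc w a Λ) (w' : P → ℂ) (Mk : Finset P) :
    markedExpect inc w w' Λ Mk =
      ∑ Z₀ ∈ Mk, ∑ X ∈ locDomains (touchFootprints inc fp Λ Z₀) (fp Z₀),
        w' Z₀ * mloc (touchFootprints inc fp Λ Z₀) (touchLocE inc fp w Λ Z₀) (fp Z₀) X := by
  rw [markedExpect_eq_sum_exp_touchLocE fp hKP]
  refine sum_congr rfl fun Z₀ _ => ?_
  rw [← mul_sum, sum_mloc_eq]

/-! ## §3 The termwise majorant (input of Part B's anchored family-sum bound) -/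

/-- `‖e^{−z} − 1‖ ≤ ‖z‖·e^{‖z‖}` (from the tree's `norm_cexp_sub_one_le_exp_norm_sub_one` and `e^x − 1 ≤ x e^x`). -/
theorem norm_cexp_neg_sub_one_le (z : ℂ) : ‖Complex.exp (-z) - 1‖ ≤ ‖z‖ * Real.exp ‖z‖ := by
  have h1 := norm_cexp_sub_one_le_exp_norm_sub_one (-z)
  rw [norm_neg] at h1
  have h2 : Real.exp ‖z‖ - 1 ≤ ‖z‖ * Real.exp ‖z‖ := by
    have hx : 0 ≤ ‖z‖ := norm_nonneg z
    -- e^x − 1 ≤ x e^x for x ≥ 0:  1 ≥ e^x (1 − x) since e^{-x} ≥ 1 − x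
    have h3 : 1 - ‖z‖ ≤ Real.exp (-‖z‖) := by
      have := Real.add_one_le_exp (-‖z‖); linarith
    have h4 : Real.exp ‖z‖ * (1 - ‖z‖) ≤ 1 := by
      calc Real.exp ‖z‖ * (1 - ‖z‖) ≤ Real.exp ‖z‖ * Real.exp (-‖z‖) :=
            mul_le_mul_of_nonneg_left h3 (Real.exp_pos _).le
        _ = 1 := by rw [← Real.exp_add, add_neg_cancel, Real.exp_zero]
    nlinarith
  exact h1.trans h2

/-- The Mayer factor is bounded by `‖tY‖e^{‖tY‖}`. -/
theorem norm_mayerU_le {κ : Type*} (t : κ → ℂ) (Y : κ) : ‖mayerU t Y‖ ≤ ‖t Y‖ * Real.exp ‖t Y‖ :=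
  norm_cexp_neg_sub_one_le (t Y)

/-- **Termwise majorant of the X-localized marked term**: `‖mloc X‖ ≤ Σ_{F: F₀ ∪ ⋃F = X} Π_{Y∈F} ‖tY‖e^{‖tY‖}` — with
`‖tY‖ ≤ ε·e^{−r₁ d(Y)}` (`B13Resummation.norm_locE_le` for the touching exponent) this is the family sum that
`B13FamilySum.familySum_le_one_via227` bounds with tree decay in `d(X)` (Part B). -/
theorem norm_mloc_le (Ys : Finset (Finset Cube)) (t : Finset Cube → ℂ) (F₀ X : Finset Cube) :
    ‖mloc Ys t F₀ X‖ ≤ ∑ F ∈ Ys.powerset with F₀ ∪ F.biUnion id = X, ∏ Y ∈ F, ‖t Y‖ * Real.exp ‖t Y‖ := by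
  unfold mloc
  refine (norm_sum_le _ _).trans (sum_le_sum fun F _ => ?_)
  rw [norm_prod]
  exact prod_le_prod (fun Y _ => norm_nonneg _) fun Y _ => norm_mayerU_le t Y

/-- With a uniform-shape bound `‖t Y‖ ≤ β Y` (β ≥ 0) the majorant becomes `Σ_F Π_{Y∈F} β(Y)e^{β(Y)}`. -/
theorem norm_mloc_le_of_bound (Ys : Finset (Finset Cube)) (t : Finset Cube → ℂ) (F₀ X : Finset Cube)
    {β : Finset Cube → ℝ} (hβ : ∀ Y ∈ Ys, ‖t Y‖ ≤ β Y) :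
    ‖mloc Ys t F₀ X‖ ≤ ∑ F ∈ Ys.powerset with F₀ ∪ F.biUnion id = X, ∏ Y ∈ F, β Y * Real.exp (β Y) := by
  refine (norm_mloc_le Ys t F₀ X).trans (sum_le_sum fun F hF => ?_)
  have hFY : F ⊆ Ys := mem_powerset.1 (mem_filter.1 hF).1
  refine prod_le_prod (fun Y _ => by positivity) fun Y hY => ?_
  have h := hβ Y (hFY hY)
  have h0 : 0 ≤ β Y := (norm_nonneg _).trans h
  exact mul_le_mul h (Real.exp_le_exp.2 h) (Real.exp_pos _).le h0

end

end Summit.QuantumFields.BalabanUV.Beta.MarkedLocalized347
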